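import Summits.BirchSwinnertonDyer.Rank1Residual.Partition.MainConjecturesIrreducible
import Summits.BirchSwinnertonDyer.Rank1Residual.X2.TwistTamagawa
import HarnessLib

/-!
# The good-ordinary IRREDUCIBLE column at MAIN-CONJECTURE level, rank one at the CLASS level
# (row C2 ∩ {r = 1} along its printed route; row C3's ordinary part through the same binder)

HONEST FRAMING (cell `b2b-bsdres`, run/shared/lean/b2b/bsd-rank1-residual/; verbatim): the goal is to
DELETE the COMBINATION-SHAPED residual classes for ALL analytic-rank `≤ 1` curves over `ℚ` — "full BSD
formula for every rank `≤ 1` curve in class `C`" assembled STRICTLY from published theorems — so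
that the rank-`≤ 1` remainder becomes exactly the CONSTRUCTION-SHAPED classes, which are TYPED
(missing-input `Prop`s), NOT attempted; this is not "finishing BSD". Theorems only; NO named fact and
NO definition; every published theorem enters as one of the tree's existing named Literature facts
BY NAME; every unproved statement enters as an EXPLICIT binder; nothing about any particular curve
is asserted; no label changes. Unit `b2b-bsdres-lit-glue` (GLUE seat), gen 2 — companion of
`Partition/MainConjecturesIrreducible.lean` (kept apart for the file-size lint), whose §3 datum-level
theorem `X11b.bsdp_rankOne_of_indexLowerBoundAt_of_goodOrd_twist_of_bcs` it lifts to the class level.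

## What this file records

| row / locus (good ordinary `p > 3`, (irr), (im), `r = 1`, `p ∤ ∏c_ℓ`) | typed inputs | published inputs (named facts) | theorem here |
|---|---|---|---|
| any odd good ordinary surjective `p`, given the column's typed MC at `p` (`hMC : ∀ V, GoodOrd V p → Irr V p → BigIm V p → MazurMainConjecture V p`) and an (im)-from-surj witness at `p` (`hIm`) | STEP L (binder `hL`, per pair, over the fields below) + `hMC` + `hIm` | as below | `bsdp_rankOne_of_indexLowerBoundAt_of_columnMainConjecture` (the generic class-level theorem; instances: BCS at `p > 3` here, Yan–Zhu at `p = 3` in `MainConjecturesIrreducibleThree.lean`) |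
| the whole BCS locus (`p > 3`, (irr), (im)) | STEP L `X11b.IndexLowerBoundAt W p K P` (binder `hL`) at every Manin-unit classical Heegner datum over a `K` with `d_K` odd, `d_K < −4`, every `ℓ ∣ N` split, `p` split — EXACTLY the data (disc), (Heeg), (spl) of BCS 2025 Thm. 1.2.4 (the BDP anticyclotomic main conjecture, PUBLISHED there: in `Λ ⊗ ℚ_p` under (irr_ℚ), in `Λ_K^{-,ur}` under (sur), `p > 3`); + BCS Thm. 1.1.2 (b) (PUBLISHED, typed) for the twist | Gross–Zagier; Kolyvagin (×2); Greenberg Thm. 4.1; Hoffstein–Luo 1997 (the field); Mazur 1978 (Manin constant) + Néron mapping property; modularity (×3); GZK | **`bsdp_rankOne_of_indexLowerBoundAt_of_bcsThm112b`** |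
| **C2 ∩ {r = 1}** (BCS Cor. 1.3.1, its PRINTED route: "Theorem 1.2.4, the `p`-adic Waldspurger formula [BDP13] …, the anticyclotomic control theorem [JSW17, Thm. 3.3.1], and the `r = 0` result for the `K`-quadratic twist of `E`", p. 4) | same | same | `RowC2.bsdp_rankOne_of_indexLowerBoundAt_of_bcsThm112b`; `RowC2.bsdp_of_bcsThm112b_of_indexLowerBoundAt` (`r ≤ 1`: no `@[conjecture]`, no Schneider certificate) |
| **C3 ∩ {ord, p ≥ 5, p ∤ ∏c_ℓ}** (JSW 2017) through the SAME binder | (irr) + (ram) ⟹ (im) (`X9.bigIm_of_irr_of_ram`), so BCS's locus contains C3's ordinary part | + JSW §7.4 Ribet fact | `RowC3.bsdp_of_indexLowerBoundAt_of_bcsThm112b` |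

On STEP L at a GOOD prime (cell finding C186, lit g36; this seat's gen-0 CORRECTION): JSW 2017 print
(eq:shalowerK-1) only for their `K'` with a NON-split `q ∣ N` and the Shimura-curve point
`z^{N⁺,N⁻}`; the tree's `IndexLowerBoundAt` reads the inequality for `K` with EVERY `ℓ ∣ N` split
(classical `X₀(N)` Heegner point). For such `K` the printed main-conjecture-level source at a good
ordinary `p > 3` is Burungale–Castella–Skinner 2025: Thm. 1.2.2 (Perrin-Riou's Heegner point main
conjecture) and Thm. 1.2.4 (the BDP / Iwasawa–Greenberg main conjecture `ch(X_Gr(E/K_∞⁻)) =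
(L_p^{BDP}(E/K))`), both for `K` with (disc) `D_K` odd `≠ −3`, (Heeg) every `ℓ ∣ N` split, (spl) `p`
split, under (irr_ℚ) in `Λ ⊗ ℚ_p` and under (sur) integrally, `p > 3` — NO ramification hypothesis, NO
conductor hypothesis, `N⁻ = 1`. The binder `hL` below is therefore quantified over EXACTLY these data
(`Odd (discr K)`, `discr K < −4`, `SatisfiesHeegnerHypothesis N K`, `SatisfiesHeegnerHypothesis p K`),
so that it reads "BCS Thm. 1.2.4 (PUBLISHED, typed nowhere: no Literature object for `X_Gr(E/K_∞⁻)` /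
`L_p^{BDP}` yet — lit-cgls sized ask S1) + BDP formula + JSW Thm. 3.3.1 control ⟹ index lower bound"
— the printed proof route of Cor. 1.3.1 (`r = 1`). The inequality itself is not displayed by BCS, so
`hL` stays a TYPED input (no Literature fact is, or could faithfully be, cited for it); what this file
proves is that NOTHING ELSE un-typed enters row C2.

References: Burungale–Castella–Skinner, IMRN 2025 rnaf082 = arXiv:2405.00270v2, Thm. 1.1.2, 1.2.2,
1.2.4, Cor. 1.3.1 and its proof, Lemma 5.2.3 [BurungaleCastellaSkinner2025]; Greenberg LNM 1716 Thm. 4.1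
[GreenbergLNM1716]; Jetchev–Skinner–Wan 2017 §7.4, Thm. 3.3.1 [JetchevSkinnerWan2017]; Gross–Zagier
1986 [GrossZagier1986]; Kolyvagin 1990 / McCallum 1991 [McCallumLMS1991]; Hoffstein–Luo 1997
[HoffsteinLuo1997]; Mazur 1978 Cor. 4.1 [Mazur1978]; Serre 1972 [Serre1972]; Silverman AEC X.5 Cor. 5.4
[SilvermanAEC2009]; Miller 2011 Def. 1.1 [Miller2011LMS]; RESIDUAL-CASES.md §a.1 C2/C3, §a.2 X9;
HOME/b2b-bsdres-lit-glue/GLUE.md §4 A1/A2, CITED-FACTS.md C186.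
-/

set_option autoImplicit false

noncomputable section

open scoped Classical MatrixGroups ModularForm

open CongruenceSubgroup WeierstrassCurve NumberField Literature.NumberTheory.EllipticCurves
  Literature.NumberTheory.EllipticCurves.ModularForms
  Literature.NumberTheory.EllipticCurves.Rank1Residual
  Literature.NumberTheory.EllipticCurves.BurungaleCastellaSkinner2025
  Summit.BirchSwinnertonDyer.BirchSwinnertonDyer.Theorems.Rank1ResidualX1Defs

namespace Summit.BirchSwinnertonDyer.Rank1Residual

/-! ### Rank one at the class level: the field of BCS Thm. 1.2.4 / Yan–Zhu Thm. 4.12 and the transports -/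

/-- **Rank one at the class level from the column's typed main conjecture (generic in the odd prime
`p`).** For `(E,p)` with `p ≥ 3` good ordinary, `ρ̄_{E,p}` surjective, `ord_{s=1} L(E,s) = 1` and
`p ∤ ∏_ℓ c_ℓ(E)`: `BSD(E,p)` from the PUBLISHED named facts — Gross–Zagier (`hGZ`), Kolyvagin (`hKo`,
`hB`), Greenberg 1999 Thm. 4.1 (`hGr`), GZK (`hGZK`), modularity (`hmod`, `hpar`, `hnf`), Hoffstein–Luo
1997 (`hHL`: the field), Mazur 1978 Cor. 4.1 (`hMaz`, Manin constant) with the Néron mapping property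
(`hNS`) — and THREE inputs at the prime `p`: `hMC`, the cyclotomic main conjecture AS THE TREE TYPES
IT (`MazurMainConjecture V p`) for every globally minimal `V` good ordinary at `p` with (irr) + (im)
(PUBLISHED: BCS 2025 Thm. 1.1.2 (b) for `p > 3`, Yan–Zhu 2026 Thm. 4.9 for `p ≥ 3`); `hIm`, the
(im)-from-surjectivity witness at `p` (a THEOREM: `X9.bigIm_of_surj` for `p ≥ 5`, Serre IV-23;
`X9.bigIm_three_of_surj` at `p = 3` granted Wuthrich 2014 Lemma 20); and `hL`, STEP L
`X11b.IndexLowerBoundAt W p K P` for THIS pair at every Manin-unit classical Heegner datum over a field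
`K` with `d_K` ODD, `d_K < −4`, every `ℓ ∣ N` split and `p` split — EXACTLY the data (disc), (Heeg),
(spl) of BCS 2025 Thm. 1.2.4 / Yan–Zhu 2026 Thm. 4.12 (the BDP anticyclotomic main conjecture for the
CLASSICAL `X₀(N)` Heegner point, PUBLISHED there under (irr_ℚ)/(sur)), whose output STEP L is along
the printed proofs of BCS Cor. 1.3.1 / YZ Thm. 4.15 (`r = 1`). Proof = that printed proof in the
kernel: sign `−1` (modularity); Hoffstein–Luo supplies `K` (x1a's
`exists_admissibleField_of_rootNumber_eq_neg_one`: `d_K ≡ 1 (mod 8)`, `d_K < −4`, every `ℓ ∣ N` and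
`p` split, `L(E^{d_K},1) ≠ 0`); `#𝓞_K^× = 2`; `p ∤ d_K`; the Manin-unit datum at `p ∤ N`
(`X11b.exists_maninDatum_of_good`); a globally minimal model of the twist (Néron) with the transports
`X11b.goodOrd_twist_model`, `X11b.surj_twist_model` (Silverman X.5.4) + `irr_of_surj` + `hIm`,
`X2.padicValNat_tamagawaProduct_twist_of_heegner_of_odd` (odd `d_K`, odd `p ∤ d_K`),
`X11b.padicValRat_u_eq_zero_of_twist_good`; then the datum-level
`X11b.bsdp_rankOne_of_indexLowerBoundAt_of_twist_mazurMainConjecture` with `hMC` at the twist.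
[cite: BurungaleCastellaSkinner2025, Cor. 1.3.1 (r = 1) and its proof (p. 4); Thm. 1.2.4; Thm. 1.1.2 (b); Lemma 5.2.3]
[cite: YanZhu2024MainConjNonCM, Thm. 4.15 (proof, §4.6), Thm. 4.12, Thm. 4.9]
[cite: HoffsteinLuo1997, Theorem (§1, pp. 435–436)] [cite: Mazur1978, Cor. 4.1]
[cite: JetchevSkinnerWan2017, §7.4.1 (pp. 30–31) (the shape of the descent)] [cite: Miller2011LMS, Def. 1.1] -/
theorem bsdp_rankOne_of_indexLowerBoundAt_of_columnMainConjecture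
    -- published inputs (named facts of the tree)
    (hGZ : ∀ (N : ℕ) [NeZero N] (W : WeierstrassCurve ℚ) (K : Type) [Field K] [NumberField K],
      gross_zagier N W K)
    (hKo : ∀ (N : ℕ) [NeZero N] (W : WeierstrassCurve ℚ) (K : Type) [Field K] [NumberField K],
      kolyvagin N W K)
    (hB : ∀ (N : ℕ) [NeZero N] (W : WeierstrassCurve ℚ) (K : Type) [Field K] [NumberField K],
      Kolyvagin1990_padicValNat_card_sha_le N W K)
    (hGr : greenberg_charValue_rankZero) (hGZK : rank_eq_analyticRank_of_analyticRank_le_one)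
    (hmod : hasEntireLFunction_rat) (hpar : nonempty_modularParametrizationData)
    (hnf : exists_isNewformOf) (hHL : HoffsteinLuo1997_exists_twist_L_one_ne_zero)
    (hMaz : mazur_not_dvd_maninConstant_of_odd) (hNS : integral_neronScaling_of_isGloballyMinimal)
    -- the pair
    (W : WeierstrassCurve ℚ) [W.IsElliptic] [W.IsGloballyMinimal] (p : ℕ) [Fact p.Prime]
    (hp3 : 3 ≤ p) (hord : GoodOrd W p) (hsurj : Surj W p) (hr : W.analyticRank = 1)
    (htam0 : ¬ p ∣ W.tamagawaProduct)
    -- the column's typed main conjecture at `p`, and the (im)-from-surj witness at `p`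
    (hMC : ∀ (V : WeierstrassCurve ℚ) [V.IsElliptic] [V.IsGloballyMinimal],
      GoodOrd V p → Irr V p → BigIm V p → MazurMainConjecture V p)
    (hIm : ∀ (V : WeierstrassCurve ℚ) [V.IsElliptic] [V.IsGloballyMinimal],
      GoodOrd V p → Surj V p → BigIm V p)
    -- the typed input (STEP L) for this pair at every Manin-unit Heegner datum over a BCS/YZ field
    (hL : ∀ (N : ℕ) [NeZero N] (K : Type) [Field K] [NumberField K]
      (Dt : ModularParametrizationData W N) (H : HeegnerDatum N (NumberField.discr K)) (ι : K →+* ℂ)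
      (P : (W.baseChange K).toAffine.Point),
      W.conductorNorm ℤ = N → IsImaginaryQuadratic K → Odd (NumberField.discr K) →
      NumberField.discr K < -4 → SatisfiesHeegnerHypothesis N K → SatisfiesHeegnerHypothesis p K →
      (W.quadraticTwist (NumberField.discr K : ℚ)).entireLFunction 1 ≠ 0 →
      WeierstrassCurve.Affine.Point.map ι.toRatAlgHom P = heegnerPointComplex Dt H →
      ¬ (p : ℤ) ∣ Dt.c → X11b.IndexLowerBoundAt W p K P) :
    BSDp W p := by
  have hpP : p.Prime := Fact.out
  have hp2 : p ≠ 2 := by omega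
  have hgood : Good W p := hord.1
  have hirr : Irr W p := irr_of_surj W p hsurj
  haveI : NeZero (W.conductorNorm ℤ) := ⟨(W.conductorNorm_pos_holds).ne'⟩
  -- the sign of the functional equation is `−1` (modularity, `r_an = 1`)
  have hw : W.rootNumber = -1 := by
    rw [WeierstrassCurve.rootNumber_eq_neg_one_pow_analyticRank_of_exists_isNewformOf hnf W, hr]
    norm_num
  -- the field (Hoffstein–Luo): `d_K ≡ 1 (mod 8)`, `d_K < −4`, every `ℓ ∣ N` and `p` split,
  -- `L(E^{d_K},1) ≠ 0`
  obtain ⟨K, _, _, hK, hodd, hlt, hHN, hHp, hLt⟩ :=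
    exists_admissibleField_of_rootNumber_eq_neg_one hnf hHL W hw p
  -- `p ∤ d_K` (`p` splits) and `w_K = 2`, prime to `p`
  have hpd : ¬ (p : ℤ) ∣ NumberField.discr K := not_dvd_discr_of_split hK hpP hp2 hHp
  have hμ : ¬ p ∣ Units.torsionOrder K := by
    haveI : IsTotallyComplex K := hK.2
    rw [Literature.NumberTheory.DiophantineGeometry.torsionOrder_eq_two_of_discr_lt hK.1 hlt]
    intro h2
    have := Nat.le_of_dvd two_pos h2
    omega
  -- the Manin-unit Heegner datum at the good prime `p`
  obtain ⟨Dt, H, ι, P, hP, hc⟩ :=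
    X11b.exists_maninDatum_of_good hnf hMaz hNS W p (W.conductorNorm ℤ) K rfl hp2 hgood hirr hK hHN
  -- a globally minimal model of the twist (Néron) and the transports
  have hD0 : (NumberField.discr K : ℚ) ≠ 0 := by exact_mod_cast NumberField.discr_ne_zero K
  haveI hEt : (W.quadraticTwist (NumberField.discr K : ℚ)).IsElliptic :=
    W.isElliptic_quadraticTwist hD0
  obtain ⟨Cd, hCd⟩ := hasGlobalMinimalModel_rat_holds (W.quadraticTwist (NumberField.discr K : ℚ))
  haveI : (Cd • W.quadraticTwist (NumberField.discr K : ℚ)).IsGloballyMinimal := hCd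
  have hWd : Cd • W.quadraticTwist (NumberField.discr K : ℚ) =
      Cd • W.quadraticTwist (NumberField.discr K : ℚ) := rfl
  have hordd : GoodOrd (Cd • W.quadraticTwist (NumberField.discr K : ℚ)) p :=
    X11b.goodOrd_twist_model W p K hK.1 hp2 hpd hord Cd hWd
  have hsurjd : Surj (Cd • W.quadraticTwist (NumberField.discr K : ℚ)) p :=
    X11b.surj_twist_model W p K hsurj Cd hWd
  have hirrd : Irr (Cd • W.quadraticTwist (NumberField.discr K : ℚ)) p := irr_of_surj _ p hsurjd
  have himd : BigIm (Cd • W.quadraticTwist (NumberField.discr K : ℚ)) p := hIm _ hordd hsurjd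
  have htam : padicValNat p (Cd • W.quadraticTwist (NumberField.discr K : ℚ)).tamagawaProduct =
      padicValNat p W.tamagawaProduct :=
    X2.padicValNat_tamagawaProduct_twist_of_heegner_of_odd W p hp2 K hK hodd hpd hHN Cd hWd
  have hu : padicValRat p (Cd.u : ℚ) = 0 :=
    X11b.padicValRat_u_eq_zero_of_twist_good W p hpd hgood Cd hWd hordd.1
  exact X11b.bsdp_rankOne_of_indexLowerBoundAt_of_twist_mazurMainConjecture W p (W.conductorNorm ℤ) K
    Dt H ι P (hGZ _ W K) (hKo _ W K) (hB _ W K) hGr hGZK hmod hpar hr hp3 hsurj htam0 hK hHN hP hc hμ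
    hLt (Cd • W.quadraticTwist (NumberField.discr K : ℚ)) Cd hWd hordd htam hu
    (hMC _ hordd hirrd himd) (hL _ K Dt H ι P rfl hK hodd hlt hHN hHp hLt hP hc)

/-- **Rank one on BCS's locus (`p > 3`, good ordinary, (irr), (im), `p ∤ ∏c_ℓ`), at the class
level**: the generic theorem with `hMC` = BCS 2025 Thm. 1.1.2 (b) (`hBCS`), `hIm` = `X9.bigIm_of_surj`
(`p ≥ 5`), surjectivity from (irr) + (im), and the typed STEP L over BCS fields quantified as a CLASS
input (all pairs of the locus). [cite: BurungaleCastellaSkinner2025, Cor. 1.3.1 (r = 1) and its proof (p. 4); Thm. 1.2.4; Thm. 1.1.2 (b)]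
[cite: Miller2011LMS, Def. 1.1] -/
theorem bsdp_rankOne_of_indexLowerBoundAt_of_bcsThm112b
    (hGZ : ∀ (N : ℕ) [NeZero N] (W : WeierstrassCurve ℚ) (K : Type) [Field K] [NumberField K],
      gross_zagier N W K)
    (hKo : ∀ (N : ℕ) [NeZero N] (W : WeierstrassCurve ℚ) (K : Type) [Field K] [NumberField K],
      kolyvagin N W K)
    (hB : ∀ (N : ℕ) [NeZero N] (W : WeierstrassCurve ℚ) (K : Type) [Field K] [NumberField K],
      Kolyvagin1990_padicValNat_card_sha_le N W K)
    (hBCS : thm112b_charIdeal_eq_padicLFunction_integral) (hGr : greenberg_charValue_rankZero)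
    (hGZK : rank_eq_analyticRank_of_analyticRank_le_one) (hmod : hasEntireLFunction_rat)
    (hpar : nonempty_modularParametrizationData) (hnf : exists_isNewformOf)
    (hHL : HoffsteinLuo1997_exists_twist_L_one_ne_zero)
    (hMaz : mazur_not_dvd_maninConstant_of_odd) (hNS : integral_neronScaling_of_isGloballyMinimal)
    (hL : ∀ (W : WeierstrassCurve ℚ) [W.IsElliptic] [W.IsGloballyMinimal] (p : ℕ) [Fact p.Prime]
      (N : ℕ) [NeZero N] (K : Type) [Field K] [NumberField K]
      (Dt : ModularParametrizationData W N) (H : HeegnerDatum N (NumberField.discr K)) (ι : K →+* ℂ)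
      (P : (W.baseChange K).toAffine.Point),
      3 < p → GoodOrd W p → Irr W p → BigIm W p → W.analyticRank = 1 → ¬ p ∣ W.tamagawaProduct →
      W.conductorNorm ℤ = N → IsImaginaryQuadratic K → Odd (NumberField.discr K) →
      NumberField.discr K < -4 → SatisfiesHeegnerHypothesis N K → SatisfiesHeegnerHypothesis p K →
      (W.quadraticTwist (NumberField.discr K : ℚ)).entireLFunction 1 ≠ 0 →
      WeierstrassCurve.Affine.Point.map ι.toRatAlgHom P = heegnerPointComplex Dt H →
      ¬ (p : ℤ) ∣ Dt.c → X11b.IndexLowerBoundAt W p K P)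
    (W : WeierstrassCurve ℚ) [W.IsElliptic] [W.IsGloballyMinimal] (p : ℕ) [Fact p.Prime]
    (hp : 3 < p) (hord : GoodOrd W p) (hirr : Irr W p) (him : BigIm W p) (hr : W.analyticRank = 1)
    (htam0 : ¬ p ∣ W.tamagawaProduct) : BSDp W p :=
  have hp5 : 5 ≤ p := (Fact.out : p.Prime).five_le_of_ne_two_of_ne_three (by omega) (by omega)
  bsdp_rankOne_of_indexLowerBoundAt_of_columnMainConjecture hGZ hKo hB hGr hGZK hmod hpar hnf hHL hMaz
    hNS W p (by omega) hord (surj_of_irr_of_bigIm W p hirr him) hr htam0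
    (fun V _ _ hordV hirrV himV ↦ hBCS V p hp hordV hirrV himV)
    (fun V _ _ _ hsV ↦ X9.bigIm_of_surj V p hp5 hsV)
    (fun N _ K _ _ Dt H ι P hN hK hodd hlt hHN hHp hLt hP hc ↦
      hL W p N K Dt H ι P hp hord hirr him hr htam0 hN hK hodd hlt hHN hHp hLt hP hc)

/-- **C2 ∩ {r = 1}, `p ∤ ∏ c_ℓ`, along its PRINTED route** (BCS Cor. 1.3.1, `r = 1`: "Theorem 1.2.4,
the `p`-adic Waldspurger formula …, the anticyclotomic control theorem [JSW17, Thm. 3.3.1], and the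
`r = 0` result for the `K`-quadratic twist"): published named facts + the typed STEP L over a BCS
field ⇒ `BSD(E,p)`; replaces, for this row, gen-0's Schneider-certificate skeleton
`RowC2.bsdp_rankOne_of_mazurMainConjecture_of_schneider` (NOT the printed route).
[cite: BurungaleCastellaSkinner2025, Cor. 1.3.1 (r = 1) and its proof (p. 4); Thm. 1.2.4] -/
theorem RowC2.bsdp_rankOne_of_indexLowerBoundAt_of_bcsThm112b
    (hGZ : ∀ (N : ℕ) [NeZero N] (W : WeierstrassCurve ℚ) (K : Type) [Field K] [NumberField K],
      gross_zagier N W K)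
    (hKo : ∀ (N : ℕ) [NeZero N] (W : WeierstrassCurve ℚ) (K : Type) [Field K] [NumberField K],
      kolyvagin N W K)
    (hB : ∀ (N : ℕ) [NeZero N] (W : WeierstrassCurve ℚ) (K : Type) [Field K] [NumberField K],
      Kolyvagin1990_padicValNat_card_sha_le N W K)
    (hBCS : thm112b_charIdeal_eq_padicLFunction_integral) (hGr : greenberg_charValue_rankZero)
    (hGZK : rank_eq_analyticRank_of_analyticRank_le_one) (hmod : hasEntireLFunction_rat)
    (hpar : nonempty_modularParametrizationData) (hnf : exists_isNewformOf)
    (hHL : HoffsteinLuo1997_exists_twist_L_one_ne_zero)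
    (hMaz : mazur_not_dvd_maninConstant_of_odd) (hNS : integral_neronScaling_of_isGloballyMinimal)
    (hL : ∀ (W : WeierstrassCurve ℚ) [W.IsElliptic] [W.IsGloballyMinimal] (p : ℕ) [Fact p.Prime]
      (N : ℕ) [NeZero N] (K : Type) [Field K] [NumberField K]
      (Dt : ModularParametrizationData W N) (H : HeegnerDatum N (NumberField.discr K)) (ι : K →+* ℂ)
      (P : (W.baseChange K).toAffine.Point),
      3 < p → GoodOrd W p → Irr W p → BigIm W p → W.analyticRank = 1 → ¬ p ∣ W.tamagawaProduct →
      W.conductorNorm ℤ = N → IsImaginaryQuadratic K → Odd (NumberField.discr K) →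
      NumberField.discr K < -4 → SatisfiesHeegnerHypothesis N K → SatisfiesHeegnerHypothesis p K →
      (W.quadraticTwist (NumberField.discr K : ℚ)).entireLFunction 1 ≠ 0 →
      WeierstrassCurve.Affine.Point.map ι.toRatAlgHom P = heegnerPointComplex Dt H →
      ¬ (p : ℤ) ∣ Dt.c → X11b.IndexLowerBoundAt W p K P)
    (W : WeierstrassCurve ℚ) [W.IsElliptic] [W.IsGloballyMinimal] (p : ℕ) [Fact p.Prime]
    (h : RowC2 W p) (hr1 : W.analyticRank = 1) (htam0 : ¬ p ∣ W.tamagawaProduct) : BSDp W p :=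
  Summit.BirchSwinnertonDyer.Rank1Residual.bsdp_rankOne_of_indexLowerBoundAt_of_bcsThm112b hGZ hKo hB
    hBCS hGr hGZK hmod hpar hnf hHL hMaz hNS hL W p h.2.1 h.2.2.1 h.2.2.2.1 h.2.2.2.2 hr1 htam0

/-- **Row C2 (`r ≤ 1`) entirely at "typed main conjecture (PUBLISHED: BCS Thm. 1.1.2 (b)) + typed STEP
L (antecedent PUBLISHED: BCS Thm. 1.2.4) + cited control"**, no `@[conjecture]`, no Schneider
certificate: `r = 0` by `RowC2.bsdp_rankZero_of_bcsThm112b`; `r = 1` (with `p ∤ ∏c_ℓ`, where STEP L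
and Kolyvagin's bound meet) by `RowC2.bsdp_rankOne_of_indexLowerBoundAt_of_bcsThm112b`.
[cite: BurungaleCastellaSkinner2025, Cor. 1.3.1 and its proof (p. 4)] [cite: Miller2011LMS, Def. 1.1] -/
theorem RowC2.bsdp_of_bcsThm112b_of_indexLowerBoundAt
    (hGZ : ∀ (N : ℕ) [NeZero N] (W : WeierstrassCurve ℚ) (K : Type) [Field K] [NumberField K],
      gross_zagier N W K)
    (hKo : ∀ (N : ℕ) [NeZero N] (W : WeierstrassCurve ℚ) (K : Type) [Field K] [NumberField K],
      kolyvagin N W K)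
    (hB : ∀ (N : ℕ) [NeZero N] (W : WeierstrassCurve ℚ) (K : Type) [Field K] [NumberField K],
      Kolyvagin1990_padicValNat_card_sha_le N W K)
    (hBCS : thm112b_charIdeal_eq_padicLFunction_integral) (hGr : greenberg_charValue_rankZero)
    (hGZK : rank_eq_analyticRank_of_analyticRank_le_one) (hmod : hasEntireLFunction_rat)
    (hpar : nonempty_modularParametrizationData) (hnf : exists_isNewformOf)
    (hHL : HoffsteinLuo1997_exists_twist_L_one_ne_zero)
    (hMaz : mazur_not_dvd_maninConstant_of_odd) (hNS : integral_neronScaling_of_isGloballyMinimal)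
    (hL : ∀ (W : WeierstrassCurve ℚ) [W.IsElliptic] [W.IsGloballyMinimal] (p : ℕ) [Fact p.Prime]
      (N : ℕ) [NeZero N] (K : Type) [Field K] [NumberField K]
      (Dt : ModularParametrizationData W N) (H : HeegnerDatum N (NumberField.discr K)) (ι : K →+* ℂ)
      (P : (W.baseChange K).toAffine.Point),
      3 < p → GoodOrd W p → Irr W p → BigIm W p → W.analyticRank = 1 → ¬ p ∣ W.tamagawaProduct →
      W.conductorNorm ℤ = N → IsImaginaryQuadratic K → Odd (NumberField.discr K) →
      NumberField.discr K < -4 → SatisfiesHeegnerHypothesis N K → SatisfiesHeegnerHypothesis p K →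
      (W.quadraticTwist (NumberField.discr K : ℚ)).entireLFunction 1 ≠ 0 →
      WeierstrassCurve.Affine.Point.map ι.toRatAlgHom P = heegnerPointComplex Dt H →
      ¬ (p : ℤ) ∣ Dt.c → X11b.IndexLowerBoundAt W p K P)
    (W : WeierstrassCurve ℚ) [W.IsElliptic] [W.IsGloballyMinimal] (p : ℕ) [Fact p.Prime]
    (h : RowC2 W p) (hr : W.analyticRank ≤ 1)
    (htam0 : W.analyticRank = 1 → ¬ p ∣ W.tamagawaProduct) : BSDp W p := by
  rcases Nat.lt_or_ge W.analyticRank 1 with h0 | h1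
  · exact RowC2.bsdp_rankZero_of_bcsThm112b hBCS hGr hpar hGZK h (by omega)
  · have hr1 : W.analyticRank = 1 := le_antisymm hr h1
    exact RowC2.bsdp_rankOne_of_indexLowerBoundAt_of_bcsThm112b hGZ hKo hB hBCS hGr hGZK hmod hpar hnf
      hHL hMaz hNS hL W p h hr1 (htam0 hr1)

/-- **Row C3's ORDINARY part (`p ≥ 5`, `p ∤ ∏c_ℓ`) through the SAME binder**: a semistable `E` with
`E[p]` irreducible and `ord_{s=1} L(E,s) = 1` has a (ram) prime (JSW §7.4, Ribet: `hRib`), hence (im)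
(`X9.bigIm_of_irr_of_ram`), so it lies on BCS's locus and `bsdp_rankOne_of_indexLowerBoundAt_of_bcsThm112b`
applies — the STEP L it consumes is over a BCS field (all `ℓ ∣ N` split, `p` split, `d_K` odd), where
the anticyclotomic main conjecture IS in print (BCS Thm. 1.2.4), unlike JSW's own `K'` (a non-split
`q`, Shimura-curve point; cell finding C186). Compare gen 0's `RowC3.bsdp_of_indexLowerBoundAt_of_mainConjectures`
(twist via Skinner–Urban). [cite: JetchevSkinnerWan2017, Thm. 1.2.1 and §7.4 (Ribet step)]
[cite: BurungaleCastellaSkinner2025, Thm. 1.2.4, Cor. 1.3.1 (proof)] -/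
theorem RowC3.bsdp_of_indexLowerBoundAt_of_bcsThm112b
    (hGZ : ∀ (N : ℕ) [NeZero N] (W : WeierstrassCurve ℚ) (K : Type) [Field K] [NumberField K],
      gross_zagier N W K)
    (hKo : ∀ (N : ℕ) [NeZero N] (W : WeierstrassCurve ℚ) (K : Type) [Field K] [NumberField K],
      kolyvagin N W K)
    (hB : ∀ (N : ℕ) [NeZero N] (W : WeierstrassCurve ℚ) (K : Type) [Field K] [NumberField K],
      Kolyvagin1990_padicValNat_card_sha_le N W K)
    (hBCS : thm112b_charIdeal_eq_padicLFunction_integral) (hGr : greenberg_charValue_rankZero)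
    (hGZK : rank_eq_analyticRank_of_analyticRank_le_one) (hmod : hasEntireLFunction_rat)
    (hpar : nonempty_modularParametrizationData) (hnf : exists_isNewformOf)
    (hHL : HoffsteinLuo1997_exists_twist_L_one_ne_zero)
    (hMaz : mazur_not_dvd_maninConstant_of_odd) (hNS : integral_neronScaling_of_isGloballyMinimal)
    (hRib : JetchevSkinnerWan2017.sec74_exists_ramifiedPrime_of_semistable)
    (hL : ∀ (W : WeierstrassCurve ℚ) [W.IsElliptic] [W.IsGloballyMinimal] (p : ℕ) [Fact p.Prime]
      (N : ℕ) [NeZero N] (K : Type) [Field K] [NumberField K]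
      (Dt : ModularParametrizationData W N) (H : HeegnerDatum N (NumberField.discr K)) (ι : K →+* ℂ)
      (P : (W.baseChange K).toAffine.Point),
      3 < p → GoodOrd W p → Irr W p → BigIm W p → W.analyticRank = 1 → ¬ p ∣ W.tamagawaProduct →
      W.conductorNorm ℤ = N → IsImaginaryQuadratic K → Odd (NumberField.discr K) →
      NumberField.discr K < -4 → SatisfiesHeegnerHypothesis N K → SatisfiesHeegnerHypothesis p K →
      (W.quadraticTwist (NumberField.discr K : ℚ)).entireLFunction 1 ≠ 0 →
      WeierstrassCurve.Affine.Point.map ι.toRatAlgHom P = heegnerPointComplex Dt H →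
      ¬ (p : ℤ) ∣ Dt.c → X11b.IndexLowerBoundAt W p K P)
    (W : WeierstrassCurve ℚ) [W.IsElliptic] [W.IsGloballyMinimal] (p : ℕ) [Fact p.Prime]
    (h : RowC3 W p) (hord : GoodOrd W p) (hp5 : 5 ≤ p) (htam0 : ¬ p ∣ W.tamagawaProduct) :
    BSDp W p := by
  obtain ⟨hr, hsst, hgood, hirr, -⟩ := h
  have hram : Ram W p :=
    JetchevSkinnerWan2017.ram_of_sec74_of_five_le hRib W p hp5 hsst hgood hirr hr
  exact bsdp_rankOne_of_indexLowerBoundAt_of_bcsThm112b hGZ hKo hB hBCS hGr hGZK hmod hpar hnf hHL hMaz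
    hNS hL W p (by omega) hord hirr (X9.bigIm_of_irr_of_ram W p hirr hram) hr htam0

end Summit.BirchSwinnertonDyer.Rank1Residual

end
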